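import Summits.QuantumFields.BalabanUV.Beta.GAN24.T2OfValueCovariance
import Summits.QuantumFields.BalabanUV.Beta.GAN24.T2SlotCovariance

/-!
# `BalabanUV.Beta.GAN24.T2OfDiffCovariance` — binder row G-an2-4 / (CONV-C), W-slot road «W3» (SKELETON-W3 v1.0 §8.3/§8.5, TRIGGER-W
# scope_update_53 (w2), ref2 REF2-DAG-AUDIT-r53 R53-2 «F4d-cov»), companion of `GAN24/T2OfValueCovariance`: (§4) its field–field
# covariance and cell ⟷ pointwise bridges INSTANTIATED at an1's tables at ANY root, every binder hypothesis discharged by name;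
# (§5) EVERY FIRST DIFFERENCE `T♮_{n+1} − T♮_n` of the normalised Stage-B tower is covariant under ALL unit translations AS A WHOLE
# TABLE — the `j`-free normalised border cancels

NOT IN PRINT; OUR BOOKKEEPING (G-an2-4 formalisation swarm, leaf prover `b2b-balaban-gan24-formalise-leaf-11`, gen 18; journal INTENT
«W3-FFCOV*» — the `t`-shape (all unit translations) half of ref2's sub-obligation «F4d-cov»; the joint BLOCK shape `u ↦ u + Lc•t` of the
whole normalised tables is leaf-19's «T2-COV*», disjoint by shift shape; module name PROVISIONAL — the row owner gan24-p1 may rename /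
re-home it).  HONEST FRAMING (cell contract, verbatim): «discharging `BetaPertH` makes Bałaban's UV stability UNCONDITIONAL — a real
constructive-QFT result; it is NOT the continuum limit and NOT the Clay problem.»  HONEST DEPENDENCY (verbatim): «continuum YM on T⁴ ⇐
BetaPertH ∧ nine spine estimates (0/9 proved); BetaPertH ⇐ (D1) ∧ (D4) ∧ CAP+tail; G-an2-4 gates asym, D1 and NE2/3/4.»

WHAT ([folklore]; generic `d`; `1 ≤ Lc`; every member / every `n`; colour constants SYMBOLIC; 0 `def`, 0 cite, 0 `def … : Prop`, 0 sorry):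
* §4 `vh₂SAt_inl_inl'` / `vh₂SAt_inr_inr'` (an1's `T₂` border at ANY root has no field–field and no multiplier–multiplier entries — its
  packer `AveragingHessianKernels.packVH` is off-diagonal by definition; leaf-19's `T2SlotUnits.vh₂S_inl_inl/inr_inr` at a general root),
  `T2Of_ff_translate_an1`, `zmode_ff_unitS₂_T2Of_iff_pointwise_an1` (`vh₂S := vh₂SAt ρ Lc`, `mixFF := mixFFAt ρ′ Lc`: `hBt` / `hBff` / `hmixt`
  discharged by an1's `vh₂SAt_translate`, `rfl`, `mixFFAt_translate`), `zmode_ff_firstDiff_iff_pointwise_base` (the literal base-root text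
  `vh₂S d Lc` of the owner's END `WSlotT2OfPieces.t2Drift_of_rows`, generic `mixFF` under its covariance binder `hmixt`).
* §5 `unitS₂_translate_of_translate` (leaf-19's two-shift `T2SlotCovariance.unitS₂_translate` (p212792) at `(w, v) = (t, −t)`, BY NAME,
  packaged over all `t`), `unitS₂_T2Of_split` (every normalised member
  = a table covariant under all unit translations + the `j`-FREE border `cB • (mfNeg ∘ vh₂S)` — leaf-19's `T2SlotUnits.unitS₂_border_eq`:
  the weight `wB2 j` cancels against the units EXACTLY), **`firstDiff_translate`** (ref2 r53's «1-covariance of `T♮₁ − T♮₀`», every `n`: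
  the borders cancel, the value parts are covariant; = the `hX` hypothesis of p211950's `zmode_ff_eq_zero_iff_pointwise` for `X := D n`),
  `firstDiff_translate_base` (the END's literal base-root text).
Asserts NO shape and NO zero-mode VALUE of Bałaban's tables; pins no colour constant; NOT a row of SKELETON-W3 §8.3 (rule (h) count
unaffected); discharges NOTHING of «T2Shape» / «T2SupRate» / (hW, hWall); 0/2 W wall binders; NOT «W-slot closed», NEVER «G-an2-4 closed»,
NOT (CONV-C); NOT BetaPertH, NOT continuum, NOT Clay.
-/

noncomputable section

open Finset
open scoped BigOperators
open Literature.MathematicalPhysics.QuantumFieldTheory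
open Literature.MathematicalPhysics.QuantumFieldTheory.Balaban1983to89
open Literature.MathematicalPhysics.QuantumFieldTheory.Balaban1983to89.Beta
open ExpKernelCalculus (MKer shiftK)
open OneStepResolventKernel (Fib)
open AffineAveraging (box toSite)
open StepJetData (mfNeg mfNeg_inl_inl mfNeg_inr_inr)
open BalabanStepW2 (wV4 wB2 Spure M1 WbalOf e4OfW T2Of T2Of_zero T2Of_succ Spure_translate M1_translate WbalOf_translate T2Of_translate
  e4OfW_translate)
open WilsonBiStencil (wilsonW₂ wilsonW₂_translate)
open AveragingMixedJetTables (vh₂S vh₂SAt mixFFAt vh₂SAt_translate vh₂S_translate mixFFAt_translate)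
open AveragingHessianKernels (packVH_inl_inl packVH_inr_inr)
open Summit.QuantumFields.BalabanUV.Beta.SecondOrderUnits (unitS₂)
open Summit.QuantumFields.BalabanUV.Beta.GAN24.CombesThomas (sfStep smStep)
open Summit.QuantumFields.BalabanUV.Beta.GAN24.T2SlotUnits (unitS₂_apply unitS₂_add unitS₂_border_eq unitS₂_step_zero)
open Summit.QuantumFields.BalabanUV.Beta.GAN24.BiStencilZeroMode (Tab zmode)
open Summit.QuantumFields.BalabanUV.Beta.GAN24.TransversalZeroMode (translate_sub)
open Summit.QuantumFields.BalabanUV.Beta.GAN24.T2SlotCovariance (unitS₂_translate)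
open Summit.QuantumFields.BalabanUV.Beta.GAN24.T2OfValueCovariance (T2Of_val_succ_translate T2Of_ff_translate
  zmode_ff_unitS₂_T2Of_iff_pointwise zmode_ff_firstDiff_iff_pointwise)

namespace Summit.QuantumFields.BalabanUV.Beta.GAN24.T2OfDiffCovariance

variable {d : ℕ}

/-! ## §4 Instances at an1's tables, any root -/

section An1

variable {Lc : ℕ} [NeZero Lc]

omit [NeZero Lc] in
/-- [folklore] an1's `T₂` border table at ANY root vanishes on the field–field block (its packer `packVH` does, by definition) —
leaf-19's `T2SlotUnits.vh₂S_inl_inl` at a general root. -/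
theorem vh₂SAt_inl_inl' (ρ : Fin (d + 1) → ℤ) (L : ℕ) (κ : Fin (d + 1)) (u : Fin (d + 1) → ℤ) (κ' : Fin (d + 1))
    (u' x z : Fin (d + 1) → ℤ) (α β : Fin (d + 1)) : vh₂SAt ρ L κ u κ' u' x z (Sum.inl α) (Sum.inl β) = 0 := rfl

omit [NeZero Lc] in
/-- [folklore] an1's `T₂` border table at ANY root vanishes on the multiplier–multiplier block. -/
theorem vh₂SAt_inr_inr' (ρ : Fin (d + 1) → ℤ) (L : ℕ) (κ : Fin (d + 1)) (u : Fin (d + 1) → ℤ) (κ' : Fin (d + 1))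
    (u' x z : Fin (d + 1) → ℤ) (μ ν : Fin (d + 1)) : vh₂SAt ρ L κ u κ' u' x z (Sum.inr μ) (Sum.inr ν) = 0 := rfl

/-- [folklore] **`T2Of_ff_translate` AT an1's TABLES, ANY ROOTS** (`vh₂S := vh₂SAt ρ Lc`, `mixFF := mixFFAt ρ′ Lc`): all three binder
hypotheses DISCHARGED by an1's `vh₂SAt_translate`, `mixFFAt_translate` and `rfl`. -/
theorem T2Of_ff_translate_an1 (hLc : 1 ≤ Lc) (ρ ρ' : Fin (d + 1) → ℤ) (cE cVH cΛ cE₂ cB : ℝ)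
    (T : Fin 4 → Fin 4 → Fin 4 → Fin 4 → ℝ) (j : ℕ) (α β κ : Fin (d + 1)) (u : Fin (d + 1) → ℤ) (κ' : Fin (d + 1))
    (u' t x z : Fin (d + 1) → ℤ) :
    T2Of d Lc cE cVH cΛ cE₂ cB T (vh₂SAt ρ Lc) (mixFFAt ρ' Lc) j κ (u + t) κ' (u' + t) x z (Sum.inl α) (Sum.inl β)
      = T2Of d Lc cE cVH cΛ cE₂ cB T (vh₂SAt ρ Lc) (mixFFAt ρ' Lc) j κ u κ' u' (x + -t) (z + -t) (Sum.inl α) (Sum.inl β) :=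
  T2Of_ff_translate hLc cE cVH cΛ cE₂ cB T (vh₂SAt_translate hLc ρ) (vh₂SAt_inl_inl' ρ Lc) (mixFFAt_translate ρ' Lc)
    j α β κ u κ' u' t x z

/-- [folklore] **THE MEMBER BRIDGE AT an1's TABLES, ANY ROOTS, ANY UNITS.** -/
theorem zmode_ff_unitS₂_T2Of_iff_pointwise_an1 {N : ℕ} (hN : N ≠ 0) (hLc : 1 ≤ Lc) (ρ ρ' : Fin (d + 1) → ℤ)
    (cE cVH cΛ cE₂ cB : ℝ) (T : Fin 4 → Fin 4 → Fin 4 → Fin 4 → ℝ) (sf sm : ℝ) (j : ℕ) :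
    (∀ (κ κ' α β : Fin (d + 1)),
        zmode N (unitS₂ sf sm (T2Of d Lc cE cVH cΛ cE₂ cB T (vh₂SAt ρ Lc) (mixFFAt ρ' Lc) j)) κ κ' (Sum.inl α) (Sum.inl β) = 0) ↔
      ∀ (κ : Fin (d + 1)) (u : Fin (d + 1) → ℤ) (κ' α β : Fin (d + 1)),
        (∑' u', ∑' x, ∑' z,
          unitS₂ sf sm (T2Of d Lc cE cVH cΛ cE₂ cB T (vh₂SAt ρ Lc) (mixFFAt ρ' Lc) j) κ u κ' u' x z (Sum.inl α) (Sum.inl β)) = 0 :=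
  zmode_ff_unitS₂_T2Of_iff_pointwise hLc cE cVH cΛ cE₂ cB T (vh₂SAt_translate hLc ρ) (vh₂SAt_inl_inl' ρ Lc)
    (mixFFAt_translate ρ' Lc) hN sf sm j

/-- [folklore] **THE FIRST-DIFFERENCE BRIDGE IN THE END's LITERAL TEXT** (base root `vh₂S d Lc` of today's `WSlotT2OfPieces.t2Drift_of_rows`,
generic `mixFF` under its covariance binder `hmixt` — an1's `mixFFAt_translate` at any root discharges it): for every `n` and `N ≠ 0`,
`∀ κ κ′ α β, zmode N (D n) κ κ′ (inl α) (inl β) = 0` ⟺ `∀ κ u κ′ α β, Σ'_{u′xz} (D n) κ u κ′ u′ x z (inl α) (inl β) = 0`. -/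
theorem zmode_ff_firstDiff_iff_pointwise_base {N : ℕ} (hN : N ≠ 0) (hLc : 1 ≤ Lc) (cE cVH cΛ cE₂ cB : ℝ)
    (T : Fin 4 → Fin 4 → Fin 4 → Fin 4 → ℝ) {mixFF : Tab d}
    (hmixt : ∀ (κ : Fin (d + 1)) (u : Fin (d + 1) → ℤ) (ρ : Fin (d + 1)) (w t : Fin (d + 1) → ℤ),
      mixFF κ (u + (Lc : ℤ) • t) ρ (w + t) = shiftK (-((Lc : ℤ) • t)) (mixFF κ u ρ w)) (n : ℕ) :
    (∀ (κ κ' α β : Fin (d + 1)),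
        zmode N (fun κ u κ' u' =>
            unitS₂ (sfStep Lc (n + 1)) (smStep d Lc (n + 1)) (T2Of d Lc cE cVH cΛ cE₂ cB T (vh₂S d Lc) mixFF (n + 1)) κ u κ' u'
              - unitS₂ (sfStep Lc n) (smStep d Lc n) (T2Of d Lc cE cVH cΛ cE₂ cB T (vh₂S d Lc) mixFF n) κ u κ' u')
          κ κ' (Sum.inl α) (Sum.inl β) = 0) ↔
      ∀ (κ : Fin (d + 1)) (u : Fin (d + 1) → ℤ) (κ' α β : Fin (d + 1)),
        (∑' u', ∑' x, ∑' z,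
          (unitS₂ (sfStep Lc (n + 1)) (smStep d Lc (n + 1)) (T2Of d Lc cE cVH cΛ cE₂ cB T (vh₂S d Lc) mixFF (n + 1)) κ u κ' u'
              - unitS₂ (sfStep Lc n) (smStep d Lc n) (T2Of d Lc cE cVH cΛ cE₂ cB T (vh₂S d Lc) mixFF n) κ u κ' u') x z
            (Sum.inl α) (Sum.inl β)) = 0 :=
  zmode_ff_firstDiff_iff_pointwise hLc cE cVH cΛ cE₂ cB T (vh₂S_translate hLc) (vh₂SAt_inl_inl' 0 Lc) hmixt hN n

end An1

/-! ## §5 Whole-table covariance of the first differences: the `j`-free normalised border cancels -/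

section Whole

variable {Lc : ℕ} [NeZero Lc]

omit [NeZero Lc] in
/-- [folklore] The change of units `unitS₂` preserves covariance under all unit translations AS A WHOLE TABLE — leaf-19's two-shift
`T2SlotCovariance.unitS₂_translate` at `(w, v) = (t, −t)`, BY NAME, packaged over all `t`. -/
theorem unitS₂_translate_of_translate (sf sm : ℝ) {X : Tab d}
    (hX : ∀ (κ : Fin (d + 1)) (u : Fin (d + 1) → ℤ) (κ' : Fin (d + 1)) (u' t : Fin (d + 1) → ℤ),
      X κ (u + t) κ' (u' + t) = shiftK (-t) (X κ u κ' u'))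
    (κ : Fin (d + 1)) (u : Fin (d + 1) → ℤ) (κ' : Fin (d + 1)) (u' t : Fin (d + 1) → ℤ) :
    unitS₂ sf sm X κ (u + t) κ' (u' + t) = shiftK (-t) (unitS₂ sf sm X κ u κ' u') :=
  unitS₂_translate (w := t) (v := -t) sf sm (fun κ u κ' u' => hX κ u κ' u' t) κ u κ' u'

variable (hLc : 1 ≤ Lc) (cE cVH cΛ cE₂ cB : ℝ) (T : Fin 4 → Fin 4 → Fin 4 → Fin 4 → ℝ)
  {vh₂S : Tab d}
  (hBt : ∀ (κ : Fin (d + 1)) (u : Fin (d + 1) → ℤ) (κ' : Fin (d + 1)) (u' t : Fin (d + 1) → ℤ),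
    vh₂S κ (u + (Lc : ℤ) • t) κ' (u' + (Lc : ℤ) • t) = shiftK (-((Lc : ℤ) • t)) (vh₂S κ u κ' u'))
  (hBff : ∀ (κ : Fin (d + 1)) (u : Fin (d + 1) → ℤ) (κ' : Fin (d + 1)) (u' x z : Fin (d + 1) → ℤ) (α β : Fin (d + 1)),
    vh₂S κ u κ' u' x z (Sum.inl α) (Sum.inl β) = 0)
  (hBmm : ∀ (κ : Fin (d + 1)) (u : Fin (d + 1) → ℤ) (κ' : Fin (d + 1)) (u' x z : Fin (d + 1) → ℤ) (μ ν : Fin (d + 1)),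
    vh₂S κ u κ' u' x z (Sum.inr μ) (Sum.inr ν) = 0)
  {mixFF : Tab d}
  (hmixt : ∀ (κ : Fin (d + 1)) (u : Fin (d + 1) → ℤ) (ρ : Fin (d + 1)) (w t : Fin (d + 1) → ℤ),
    mixFF κ (u + (Lc : ℤ) • t) ρ (w + t) = shiftK (-((Lc : ℤ) • t)) (mixFF κ u ρ w))

include hLc hBt hBff hBmm hmixt in
/-- [folklore] **EVERY NORMALISED MEMBER SPLITS AS (a table covariant under all unit translations) + (the `j`-FREE border `cB • (mfNeg ∘ vh₂S)`)**:
member `0` in units `1` (`T2SlotUnits.unitS₂_step_zero`), member `j+1` by `T2SlotUnits.unitS₂_add` / `unitS₂_border_eq` (the weight `wB2 (j+1)`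
cancels against the units EXACTLY) with the value part of `T2Of_val_succ_translate` carried through `unitS₂_translate_of_translate`. -/
theorem unitS₂_T2Of_split : ∀ m : ℕ, ∃ V : Tab d,
    (∀ (κ : Fin (d + 1)) (u : Fin (d + 1) → ℤ) (κ' : Fin (d + 1)) (u' t : Fin (d + 1) → ℤ),
        V κ (u + t) κ' (u' + t) = shiftK (-t) (V κ u κ' u')) ∧
      unitS₂ (sfStep Lc m) (smStep d Lc m) (T2Of d Lc cE cVH cΛ cE₂ cB T vh₂S mixFF m)
        = fun κ u κ' u' => V κ u κ' u' + cB • mfNeg (vh₂S κ u κ' u')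
  | 0 => by
    refine ⟨fun κ u κ' u' => cE₂ • wilsonW₂ d T κ u κ' u', fun κ u κ' u' t => ?_, ?_⟩
    · show cE₂ • wilsonW₂ d T κ (u + t) κ' (u' + t) = shiftK (-t) (cE₂ • wilsonW₂ d T κ u κ' u')
      rw [wilsonW₂_translate]
      rfl
    · rw [unitS₂_step_zero, T2Of_zero]
  | j + 1 => by
    refine ⟨unitS₂ (sfStep Lc (j + 1)) (smStep d Lc (j + 1)) (fun κ u κ' u' =>
        (cE₂ * wV4 d Lc (j + 1)) • e4OfW d Lc j (Spure d Lc cE cVH cΛ j) (M1 d Lc cΛ j)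
          (WbalOf d Lc cE cVH cΛ (T2Of d Lc cE cVH cΛ cE₂ cB T vh₂S mixFF) mixFF j) κ u κ' u'),
      unitS₂_translate_of_translate _ _ (fun κ u κ' u' t => T2Of_val_succ_translate hLc cE cVH cΛ cE₂ cB T hBt hmixt j κ u κ' u' t), ?_⟩
    have h : T2Of d Lc cE cVH cΛ cE₂ cB T vh₂S mixFF (j + 1) = fun κ u κ' u' =>
        (fun κ u κ' u' => (cE₂ * wV4 d Lc (j + 1)) • e4OfW d Lc j (Spure d Lc cE cVH cΛ j) (M1 d Lc cΛ j)
            (WbalOf d Lc cE cVH cΛ (T2Of d Lc cE cVH cΛ cE₂ cB T vh₂S mixFF) mixFF j) κ u κ' u') κ u κ' u'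
          + (fun κ u κ' u' => (cB * wB2 d Lc (j + 1)) • mfNeg (vh₂S κ u κ' u')) κ u κ' u' := rfl
    rw [h, unitS₂_add,
      unitS₂_border_eq cB (fun κ u κ' u' => mfNeg (vh₂S κ u κ' u')) (fun κ u κ' u' x z α β => by rw [mfNeg_inl_inl, hBff])
        (fun κ u κ' u' x z μ ν => by rw [mfNeg_inr_inr, hBmm]) (j + 1)]

include hLc hBt hBff hBmm hmixt in
/-- [folklore] **EVERY FIRST DIFFERENCE `T♮_{n+1} − T♮_n` OF THE NORMALISED TOWER IS COVARIANT UNDER ALL UNIT TRANSLATIONS AS A WHOLE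
TABLE** (ref2 r53's «1-covariance of `T♮₁ − T♮₀`» at `n = 0`): the `j`-free normalised borders cancel and the value parts are covariant
(`unitS₂_T2Of_split`, leaf-16's `translate_sub`).  This is the `hX` hypothesis of p211950's `zmode_ff_eq_zero_iff_pointwise` for `X := D n`. -/
theorem firstDiff_translate (n : ℕ) (κ : Fin (d + 1)) (u : Fin (d + 1) → ℤ) (κ' : Fin (d + 1)) (u' t : Fin (d + 1) → ℤ) :
    (fun κ u κ' u' => unitS₂ (sfStep Lc (n + 1)) (smStep d Lc (n + 1)) (T2Of d Lc cE cVH cΛ cE₂ cB T vh₂S mixFF (n + 1)) κ u κ' u'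
        - unitS₂ (sfStep Lc n) (smStep d Lc n) (T2Of d Lc cE cVH cΛ cE₂ cB T vh₂S mixFF n) κ u κ' u') κ (u + t) κ' (u' + t)
      = shiftK (-t) ((fun κ u κ' u' =>
          unitS₂ (sfStep Lc (n + 1)) (smStep d Lc (n + 1)) (T2Of d Lc cE cVH cΛ cE₂ cB T vh₂S mixFF (n + 1)) κ u κ' u'
            - unitS₂ (sfStep Lc n) (smStep d Lc n) (T2Of d Lc cE cVH cΛ cE₂ cB T vh₂S mixFF n) κ u κ' u') κ u κ' u') := by
  obtain ⟨V₁, hV₁, e₁⟩ := unitS₂_T2Of_split hLc cE cVH cΛ cE₂ cB T hBt hBff hBmm hmixt (n + 1)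
  obtain ⟨V₀, hV₀, e₀⟩ := unitS₂_T2Of_split hLc cE cVH cΛ cE₂ cB T hBt hBff hBmm hmixt n
  have hD : (fun κ u κ' u' =>
        unitS₂ (sfStep Lc (n + 1)) (smStep d Lc (n + 1)) (T2Of d Lc cE cVH cΛ cE₂ cB T vh₂S mixFF (n + 1)) κ u κ' u'
          - unitS₂ (sfStep Lc n) (smStep d Lc n) (T2Of d Lc cE cVH cΛ cE₂ cB T vh₂S mixFF n) κ u κ' u') = V₁ - V₀ := by
    rw [e₁, e₀]
    funext κ u κ' u'
    simp only [Pi.sub_apply]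
    abel
  rw [hD]
  exact translate_sub hV₁ hV₀ κ u κ' u' t

end Whole

section WholeBase

variable {Lc : ℕ} [NeZero Lc]

/-- [folklore] **`firstDiff_translate` IN THE END's LITERAL TEXT** (base root `vh₂S d Lc`; generic `mixFF` under `hmixt`). -/
theorem firstDiff_translate_base (hLc : 1 ≤ Lc) (cE cVH cΛ cE₂ cB : ℝ) (T : Fin 4 → Fin 4 → Fin 4 → Fin 4 → ℝ) {mixFF : Tab d}
    (hmixt : ∀ (κ : Fin (d + 1)) (u : Fin (d + 1) → ℤ) (ρ : Fin (d + 1)) (w t : Fin (d + 1) → ℤ),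
      mixFF κ (u + (Lc : ℤ) • t) ρ (w + t) = shiftK (-((Lc : ℤ) • t)) (mixFF κ u ρ w))
    (n : ℕ) (κ : Fin (d + 1)) (u : Fin (d + 1) → ℤ) (κ' : Fin (d + 1)) (u' t : Fin (d + 1) → ℤ) :
    (fun κ u κ' u' =>
        unitS₂ (sfStep Lc (n + 1)) (smStep d Lc (n + 1)) (T2Of d Lc cE cVH cΛ cE₂ cB T (vh₂S d Lc) mixFF (n + 1)) κ u κ' u'
          - unitS₂ (sfStep Lc n) (smStep d Lc n) (T2Of d Lc cE cVH cΛ cE₂ cB T (vh₂S d Lc) mixFF n) κ u κ' u') κ (u + t) κ' (u' + t)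
      = shiftK (-t) ((fun κ u κ' u' =>
          unitS₂ (sfStep Lc (n + 1)) (smStep d Lc (n + 1)) (T2Of d Lc cE cVH cΛ cE₂ cB T (vh₂S d Lc) mixFF (n + 1)) κ u κ' u'
            - unitS₂ (sfStep Lc n) (smStep d Lc n) (T2Of d Lc cE cVH cΛ cE₂ cB T (vh₂S d Lc) mixFF n) κ u κ' u') κ u κ' u') :=
  firstDiff_translate hLc cE cVH cΛ cE₂ cB T (vh₂S_translate hLc) (vh₂SAt_inl_inl' 0 Lc) (vh₂SAt_inr_inr' 0 Lc) hmixt n κ u κ' u' t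

end WholeBase

end Summit.QuantumFields.BalabanUV.Beta.GAN24.T2OfDiffCovariance

end
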